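/-
COR-CM (cells pub-hodgecm / pub-hodgecm2, Hodge ladder stage 2) — TRANSPOSITION item (vi), sub-binder S2 `supply`
(hodge-director/ITEM6-SPLIT.md §(c)/§5): the CM SIDE of the object match, as a KERNEL THEOREM.  Written by the stage-1
binder seat pub-hodgecm-mc-binder-1 (gen 21, prover-pub-hodgecm-mc-binder-1-g21-0) in its own count-neutral lane
(theorems only: no definition, no named fact, nothing asserted; nothing under `CorCM/B01/` or `CorCM/B01/Transposition/`
is edited or restated).  HC_CM is NOT proved.
-/
import Summits.HodgeConjecture.CorCM.ShimuraIsogenousPowerHolds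
import Summits.HodgeConjecture.HodgeConjecture.Theorems.CorCMDomination
import Summits.HodgeConjecture.CorCM.Model.Universe
import Literature.AlgebraicGeometry.Motives.AbelianVarietySimpleFactorsUnique
import HarnessLib

/-!
# The CM side of the S2 object match: non-zero homomorphisms transfer across a common CM sub-pair

Context.  In the AS-PRINTED rewire of item (vi) (`Transposition/Item6SupplyAsPrinted.lean`, item6-p1; ITEM6-SPLIT §5) the
residual binder `hMatch` of the S2 junction turns a non-zero element of Liu's `Hom_E(A_K, A_μ)_ℚ` ([Liu2021] Thm. 4.18 (1))
into a non-zero homomorphism `Alb(P_Γ(V)) ⟶ A_{(F,Φ)} = (cmRealisation h₃ (cmCode F Φ)).AV`.  It is the composite of a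
SHIMURA-side match (C0/C6a: `Sh(𝕍)_K ⊗_{E,ι₁} ℂ ⊇ P_Γ(V)`, Albanese compatibility) and a CM-side match (C6b*, b01-idea-1
`HOME/b01/IDEA-1l-inverse-type-c6b.md`; item6-p1 MATCH-SPLIT note, pub-hodgecm2/INBOX 2026-08-21T14:03:32Z):
«`Hom(A_μ ⊗_{E,ι₁} ℂ, A_{(F,Φ)}) ≠ 0` when `A_μ ⊗_{E,ι₁} ℂ` is isotypic of a type sharing the primitive core of `Φ`».
By [Liu2021] Def. 4.5 (2) (tree `Liu2021.LiuCMData.cmType_eq_induced_of_det45`) `A_μ ⊗_{E,ι₁} ℂ` realises, over `M_μ`,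
the type INDUCED from a pair `(M'_μ, S)`; so the CM side is exactly the following statement, proved here for ARBITRARY data:

* §1 (categorical, `AbelianVariety ℂ`): a non-zero homomorphism `u : X ⟶ A` stays non-zero after composition with an
  isogeny (`comp_ne_zero_of_isIsogeny`), with the inclusion of an isogeny factor (`comp_ne_zero_of_comp_eq_nsmul_id`,
  `exists_hom_ne_zero_of_avDominatedBy`), and has a non-zero coordinate in a categorical power
  (`exists_comp_proj_ne_zero`) — Mumford §19 (quasi-inverses `g ≫ g' = [n]`, `Hom` torsion-free), all tree theorems.
* §2 (CM): if `(B, ι_B, θ_B)` realises on `H¹` a CM type of a CM field `M` INDUCED from `(K₀; Φ₀)` along `e : K₀ → M`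
  (`IsCMTypeRealisation (inducedCMType e Φ₀) B ι_B θ_B`), then every non-zero `u : X ⟶ B` yields a non-zero
  `X ⟶ B₀` into a realisation of `(K₀; Φ₀)` (`exists_hom_realisation_ne_zero_of_induced`, Shimura 1998 §6.2 Thm. 3:
  `B ∼ B₀^h`, tree theorem `shimura1998_Thm3_isogenousPower_holds`), hence a non-zero `X ⟶ A` into EVERY realisation `A`
  of ANY type induced from `(K₀; Φ₀)` (`exists_hom_ne_zero_of_common_subpair`, via `Domination.avDominatedBy_of_inducedCMType`:
  `B₀` is an isogeny factor of `A`).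
* §3 (model universe of record): with `A := (cmRealisation h₃ (Model.cmCode F Φ)).AV`, `F : CMField`, `Φ` induced from
  `(K₀; Φ₀)` along `k : K₀ → F` — `Model.exists_hom_cmAV_ne_zero_of_common_subpair` (equality form) and
  `Model.exists_hom_cmAV_ne_zero_of_forall_mem_iff` (membership form `τ ∈ Φ ↔ τ ∘ k ∈ Φ₀`); and the literal (C6b*)
  `Model.exists_hom_cmAV_ne_zero_self` (`X = B`, `Hom(B, A_{(F,Φ)}) ≠ 0`).

USE (for the S2 junction writer; nothing here is wired): split `hMatch` into (C0/C6a) «`φ ≠ 0 ⇒ ∃ Γ 𝒥 B (realising a type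
induced from some `(K₀; Φ₀)` that also induces `Φ`) (u : 𝒥.J ⟶ B), u ≠ 0`» and obtain the conclusion of `hMatch` by
`Model.exists_hom_cmAV_ne_zero_of_forall_mem_iff`.  The remaining Galois identity «for `μ` of type `Φ^{*ι₁}` the pair
`(M'_μ, Ψ_μ)` of [Liu2021] Def. 4.3 (2) induces `Φ`» is CM-type combinatorics on the reflex (Shimura §8 Prop. 28; tree
`Literature/NumberTheory/ComplexMultiplication/ReflexType.lean`), not addressed in this file.

References: D. Mumford, *Abelian Varieties* (1970) §19 (Thm. 1, Remark p. 169, Thm. 3); G. Shimura, *Abelian Varieties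
with Complex Multiplication and Modular Functions* (1998) §6.1 Cor. of Thm. 2, §6.2 Thm. 3; Y. Liu, *Fourier–Jacobi cycles
and arithmetic relative trace formula*, Camb. J. Math. 9 (2021), Def. 4.5 (2), Prop. 4.6 (1), Thm. 4.18 (1).
-/

noncomputable section

open CategoryTheory CategoryTheory.Limits NumberField
open Literature.AlgebraicGeometry.Motives
open Literature.AlgebraicGeometry.HodgeTheory (complexBetti)
open Literature.AlgebraicGeometry.ComplexMultiplication
open Literature.NumberTheory.ComplexMultiplication (inducedCMType mem_inducedCMType_iff inducedCMType_comp)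
open Literature.NumberTheory.Automorphic.PicardCM (CMCode cmRealisation CMAbelianVarietyRealised)

namespace Summit.HodgeConjecture.CorCM

namespace CMReach

/-! ## §1 Non-zero homomorphisms of complex abelian varieties: isogenies, factors, coordinates -/

section Categorical

variable {X A B P : AbelianVariety ℂ}

/-- **A split-mono-up-to-`[N]` kills no non-zero homomorphism**: if `s ≫ p = N • 𝟙 A` with `N ≠ 0` then
`u ≠ 0 ⇒ u ≫ s ≠ 0` (`N • u = u ≫ s ≫ p`, and `Hom(X, A)` is torsion-free, Milne 1986 Lemma 12.2 — tree theorem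
`AbelianVariety.hom_eq_zero_of_nsmul_eq_zero`). [cite: MumfordAV1970, §19 Thm. 3 (p. 176) and Remark p. 169] -/
theorem comp_ne_zero_of_comp_eq_nsmul_id {s : A ⟶ P} {p : P ⟶ A} {N : ℕ} (hN : N ≠ 0) (hsp : s ≫ p = N • 𝟙 A)
    {u : X ⟶ A} (hu : u ≠ 0) : u ≫ s ≠ 0 := by
  intro h0
  apply hu
  refine AbelianVariety.hom_eq_zero_of_nsmul_eq_zero hN ?_
  calc N • u = u ≫ (s ≫ p) := by rw [hsp, Preadditive.comp_nsmul, Category.comp_id]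
    _ = 0 := by rw [← Category.assoc, h0, zero_comp]

/-- **Isogenies kill no non-zero homomorphism**: for an isogeny `g : A ⟶ B` and `u : X ⟶ A`, `u ≠ 0 ⇒ u ≫ g ≠ 0`
(a quasi-inverse `g'` with `g ≫ g' = [n]_A`, `n ≥ 1`: tree theorem `IsIsogeny.exists_nsmul_inverse_holds`).
[cite: MumfordAV1970, §19 Remark p. 169] -/
theorem comp_ne_zero_of_isIsogeny {g : A ⟶ B} (hg : AbelianVariety.IsIsogeny g) {u : X ⟶ A} (hu : u ≠ 0) :
    u ≫ g ≠ 0 := by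
  obtain ⟨g', n, hn, hgg', -⟩ := AbelianVariety.IsIsogeny.exists_nsmul_inverse_holds hg
  exact comp_ne_zero_of_comp_eq_nsmul_id hn.ne' hgg' hu

/-- **An isogeny factor receives a non-zero homomorphism whenever the factor does**: if `A` is dominated by `P`
(`Domination.AVDominatedBy A P`: `s ≫ p = [N]_A`, `N ≠ 0`) then every non-zero `u : X ⟶ A` gives the non-zero
`u ≫ s : X ⟶ P`. [cite: MumfordAV1970, §19 Thm. 3 (p. 176) and Remark p. 169] -/
theorem exists_hom_ne_zero_of_avDominatedBy (h : Domination.AVDominatedBy A P) {u : X ⟶ A} (hu : u ≠ 0) :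
    ∃ v : X ⟶ P, v ≠ 0 := by
  obtain ⟨s, p, N, hN, hsp⟩ := h
  exact ⟨u ≫ s, comp_ne_zero_of_comp_eq_nsmul_id hN hsp hu⟩

/-- **A non-zero homomorphism into a categorical power has a non-zero coordinate**: if `(P, π_j)_{j<h}` is a limit
fan and `w : X ⟶ P` is non-zero, then `w ≫ π_j ≠ 0` for some `j` (a morphism into a limit is determined by its
components; for `h = 0` this says `w = 0`). [cite: MumfordAV1970, §19 Thm. 1 Cor. 1 (p. 173)] -/
theorem exists_comp_proj_ne_zero {h : ℕ} {π : Fin h → (P ⟶ B)} (hlim : IsLimit (Fan.mk P π)) {w : X ⟶ P}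
    (hw : w ≠ 0) : ∃ j : Fin h, w ≫ π j ≠ 0 := by
  by_contra hall
  push Not at hall
  apply hw
  refine hlim.hom_ext fun j => ?_
  obtain ⟨j⟩ := j
  change w ≫ (Fan.mk P π).π.app ⟨j⟩ = 0 ≫ (Fan.mk P π).π.app ⟨j⟩
  rw [Fan.mk_π_app, zero_comp]
  exact hall j

end Categorical

/-! ## §2 The CM side: a realisation of an induced type passes non-zero homomorphisms down to the base pair
and up to every other inflation -/

section CMSide

variable {K₀ : Type} [Field K₀] [NumberField K₀] [IsCMField K₀]
variable {M : Type} [Field M] [NumberField M] [IsCMField M]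
variable {L : Type} [Field L] [NumberField L] [IsCMField L]

/-- **Down to the base pair.**  If `(B, ι_B, θ_B)` realises on `H¹` the CM type of `M` induced from `(K₀; Φ₀)` along
`e : K₀ → M` and `u : X ⟶ B` is a non-zero homomorphism of complex abelian varieties, then there are a realisation
`(B₀, ι₀, θ₀)` of `(K₀; Φ₀)` and a NON-ZERO homomorphism `X ⟶ B₀`: by Shimura's Theorem 3 (tree theorem
`shimura1998_Thm3_isogenousPower_holds`) `B` is isogenous (`g`) to a categorical power `∏_{j<h} B₀`; `u ≫ g ≠ 0`
(`comp_ne_zero_of_isIsogeny`) has a non-zero coordinate (`exists_comp_proj_ne_zero`).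
[cite: Shimura1998, §6.2 Theorem 3 with proof (pp. 41–43)] -/
theorem exists_hom_realisation_ne_zero_of_induced (hd : Shimura1998_Thm3_isogenousPower)
    (e : K₀ →+* M) (Φ₀ : CMType K₀)
    {B : AbelianVariety ℂ} {ιB : 𝓞 M →+* End B} {θB : M →+* Module.End ℂ (complexBetti B.X 1)}
    (hB : IsCMTypeRealisation (inducedCMType e Φ₀) B ιB θB)
    {X : AbelianVariety ℂ} {u : X ⟶ B} (hu : u ≠ 0) :
    ∃ (B₀ : AbelianVariety ℂ) (ι₀ : 𝓞 K₀ →+* End B₀) (θ₀ : K₀ →+* Module.End ℂ (complexBetti B₀.X 1)),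
      IsCMTypeRealisation Φ₀ B₀ ι₀ θ₀ ∧ ∃ v : X ⟶ B₀, v ≠ 0 := by
  obtain ⟨B₀, ι₀, θ₀, hB₀, h, P, π, ⟨hlim⟩, g, hg, -⟩ := hd K₀ M e Φ₀ B ιB θB hB
  obtain ⟨j, hj⟩ := exists_comp_proj_ne_zero hlim (comp_ne_zero_of_isIsogeny hg hu)
  exact ⟨B₀, ι₀, θ₀, hB₀, (u ≫ g) ≫ π j, hj⟩

/-- **Across a common sub-pair.**  Let `(K₀; Φ₀)` be a CM pair, `e : K₀ → M` and `k : K₀ → L` ring maps into CM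
fields, `(B, ι_B, θ_B)` a realisation of `(M; Φ₀^M)` and `(A, ι_A, θ_A)` a realisation of `(L; Φ₀^L)` (induced types).
Then every non-zero homomorphism `u : X ⟶ B` yields a NON-ZERO homomorphism `X ⟶ A`: down to a realisation `B₀` of
`(K₀; Φ₀)` (`exists_hom_realisation_ne_zero_of_induced`), and `B₀` is an isogeny factor of `A` (Shimura §6.2 Thm. 3 +
§6.1 Cor., tree `Domination.avDominatedBy_of_inducedCMType`), which preserves non-vanishing
(`exists_hom_ne_zero_of_avDominatedBy`).  In particular (`A`, `B` two realisations over possibly different fields):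
abelian varieties whose CM types share a sub-pair share non-zero homomorphisms from any source.
[cite: Shimura1998, §6.2 Theorem 3 and §6.1 Corollary of Theorem 2 (pp. 41–43)] -/
theorem exists_hom_ne_zero_of_common_subpair (hd : Shimura1998_Thm3_isogenousPower) (hcor : Shimura1998_Thm2_Cor)
    (Φ₀ : CMType K₀) (e : K₀ →+* M) (k : K₀ →+* L)
    {B : AbelianVariety ℂ} {ιB : 𝓞 M →+* End B} {θB : M →+* Module.End ℂ (complexBetti B.X 1)}
    (hB : IsCMTypeRealisation (inducedCMType e Φ₀) B ιB θB)
    {A : AbelianVariety ℂ} {ιA : 𝓞 L →+* End A} {θA : L →+* Module.End ℂ (complexBetti A.X 1)}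
    (hA : IsCMTypeRealisation (inducedCMType k Φ₀) A ιA θA)
    {X : AbelianVariety ℂ} {u : X ⟶ B} (hu : u ≠ 0) :
    ∃ v : X ⟶ A, v ≠ 0 := by
  obtain ⟨B₀, ι₀, θ₀, hB₀, v, hv⟩ := exists_hom_realisation_ne_zero_of_induced hd e Φ₀ hB hu
  exact exists_hom_ne_zero_of_avDominatedBy (Domination.avDominatedBy_of_inducedCMType hd hcor k Φ₀ hB₀ hA) hv

/-- A realisation of a CM type is not the zero abelian variety: `𝟙 B ≠ 0` (`dim B = [M:ℚ]/2 ≥ 1`, tree theorems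
`Motives.schemeDim_eq_holds`, `AbelianVariety.id_ne_zero_of_dim_pos`; `[M:ℚ] ≥ 2` for a CM field).
[cite: Shimura1998, §5.2 (pp. 36–37)] -/
theorem id_ne_zero_of_isCMTypeRealisation {Θ : CMType M}
    {B : AbelianVariety ℂ} {ιB : 𝓞 M →+* End B} {θB : M →+* Module.End ℂ (complexBetti B.X 1)}
    (hB : IsCMTypeRealisation Θ B ιB θB) : (𝟙 B : B ⟶ B) ≠ 0 := by
  refine AbelianVariety.id_ne_zero_of_dim_pos ?_
  rw [show B.dim = Module.finrank ℚ M / 2 from Literature.AlgebraicGeometry.Motives.schemeDim_eq_holds hB.1]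
  have h2 : 2 ≤ Module.finrank ℚ M := by
    have h := IsTotallyComplex.finrank M
    have hpos : 0 < Module.finrank ℚ M := Module.finrank_pos
    omega
  omega

end CMSide

end CMReach

/-! ## §3 On the model universe of record: reaching `A_{(F,Φ)} = (cmRealisation h₃ (cmCode F Φ)).AV` -/

namespace Model

open CMReach

variable {K₀ : Type} [Field K₀] [NumberField K₀] [IsCMField K₀]
variable {M : Type} [Field M] [NumberField M] [IsCMField M]

omit [NumberField K₀] [IsCMField K₀] in
/-- The coded type of `cmCode F (Φ₀^F)` is induced from `(K₀; Φ₀)` along `cmCodeEquiv F _ ∘ k`. [folklore] -/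
theorem inducedCMType_cmCodeEquiv_comp (F : CMField) (k : K₀ →+* F) (Φ₀ : CMType K₀) :
    inducedCMType ((cmCodeEquiv F (inducedCMType k Φ₀)).toRingHom.comp k) Φ₀ =
      (cmCode F (inducedCMType k Φ₀)).Φ := by
  rw [inducedCMType_comp]
  rfl

/-- **CM-side reach transfer to the chosen realisation `A_{(F,Φ₀^F)}`** (KERNEL, no hypothesis beyond the tree's
record (iii) `h₃`): if `(B, ι_B, θ_B)` realises a type of a CM field `M` induced from `(K₀; Φ₀)` (e.g. Liu's
`A_μ ⊗_{E,ι₁} ℂ` over `M = M_μ`, `(K₀; Φ₀) = (M'_μ, Ψ_μ)`, [Liu2021] Def. 4.5 (2) via `LiuCMData.cmType_eq_induced_of_det45`)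
and `k : K₀ → F`, then every non-zero `u : X ⟶ B` (e.g. `X = Alb(P_Γ(V))`) gives a non-zero
`X ⟶ (cmRealisation h₃ (cmCode F (inducedCMType k Φ₀))).AV`.
[cite: Shimura1998, §6.2 Theorem 3 and §6.1 Corollary of Theorem 2 (pp. 41–43)] [cite: Liu2021, Def. 4.5 (2)] -/
theorem exists_hom_cmAV_ne_zero_of_common_subpair (h₃ : CMAbelianVarietyRealised)
    (Φ₀ : CMType K₀) (e : K₀ →+* M)
    {B : AbelianVariety ℂ} {ιB : 𝓞 M →+* End B} {θB : M →+* Module.End ℂ (complexBetti B.X 1)}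
    (hB : IsCMTypeRealisation (inducedCMType e Φ₀) B ιB θB)
    (F : CMField) (k : K₀ →+* F) {X : AbelianVariety ℂ} {u : X ⟶ B} (hu : u ≠ 0) :
    ∃ v : X ⟶ (cmRealisation h₃ (cmCode F (inducedCMType k Φ₀))).AV, v ≠ 0 := by
  have hA := Literature.AlgebraicGeometry.Milne1999.cmRealisation_isCMTypeRealisation h₃
    (cmCode F (inducedCMType k Φ₀))
  rw [← inducedCMType_cmCodeEquiv_comp F k Φ₀] at hA
  exact exists_hom_ne_zero_of_common_subpair shimura1998_Thm3_isogenousPower_and_Thm2_cor.1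
    shimura1998_Thm3_isogenousPower_and_Thm2_cor.2 Φ₀ e _ hB hA hu

/-- **The same, membership form** (the shape in which a CM type of `F` «is induced from `(K₀; Φ₀)` along `k`» is
checked in practice: `τ ∈ Φ ↔ τ ∘ k ∈ Φ₀` for all `τ : F → ℂ`). [cite: Shimura1998, §6.2 Theorem 3 (pp. 41–43)] -/
theorem exists_hom_cmAV_ne_zero_of_forall_mem_iff (h₃ : CMAbelianVarietyRealised)
    (Φ₀ : CMType K₀) (e : K₀ →+* M)
    {B : AbelianVariety ℂ} {ιB : 𝓞 M →+* End B} {θB : M →+* Module.End ℂ (complexBetti B.X 1)}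
    (hB : IsCMTypeRealisation (inducedCMType e Φ₀) B ιB θB)
    (F : CMField) (k : K₀ →+* F) (Φ : CMType F) (hΦ : ∀ τ : F →+* ℂ, τ ∈ Φ.1 ↔ τ.comp k ∈ Φ₀.1)
    {X : AbelianVariety ℂ} {u : X ⟶ B} (hu : u ≠ 0) :
    ∃ v : X ⟶ (cmRealisation h₃ (cmCode F Φ)).AV, v ≠ 0 := by
  have hΦeq : Φ = inducedCMType k Φ₀ :=
    Subtype.ext (Set.ext fun τ => (hΦ τ).trans (mem_inducedCMType_iff k Φ₀ τ).symm)
  subst hΦeq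
  exact exists_hom_cmAV_ne_zero_of_common_subpair h₃ Φ₀ e hB F k hu

/-- **(C6b*) literally: `Hom(B, A_{(F,Φ)}) ≠ 0`** for every realisation `B` of a type induced from a sub-pair `(K₀; Φ₀)`
that also induces `Φ` (take `X = B`, `u = 𝟙 B ≠ 0`).  With `B = A_μ ⊗_{E,ι₁} ℂ` and `μ` of type `Φ^{*ι₁}` this is the
CM-side match of ITEM6-SPLIT §5 / b01-idea-1 IDEA-1l; the Shimura-side match (C0/C6a) is untouched.
[cite: Shimura1998, §6.2 Theorem 3 and §6.1 Corollary of Theorem 2 (pp. 41–43)] [cite: Liu2021, Def. 4.5 (2)] -/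
theorem exists_hom_cmAV_ne_zero_self (h₃ : CMAbelianVarietyRealised)
    (Φ₀ : CMType K₀) (e : K₀ →+* M)
    {B : AbelianVariety ℂ} {ιB : 𝓞 M →+* End B} {θB : M →+* Module.End ℂ (complexBetti B.X 1)}
    (hB : IsCMTypeRealisation (inducedCMType e Φ₀) B ιB θB)
    (F : CMField) (k : K₀ →+* F) (Φ : CMType F) (hΦ : ∀ τ : F →+* ℂ, τ ∈ Φ.1 ↔ τ.comp k ∈ Φ₀.1) :
    ∃ v : B ⟶ (cmRealisation h₃ (cmCode F Φ)).AV, v ≠ 0 :=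
  exists_hom_cmAV_ne_zero_of_forall_mem_iff h₃ Φ₀ e hB F k Φ hΦ (id_ne_zero_of_isCMTypeRealisation hB)

end Model

end Summit.HodgeConjecture.CorCM

end
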